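import Summits.AnomalousDissipation.AnomalousDissipation.Theorems.SolenoidalFractalHomogenisationRealisedQuasiStaticCellLawUpperSomeLadder
import Literature.Analysis.FluidPDE.QuasiStaticSlotWeight
import HarnessLib

/-!
# K2R `RealisedQuasiStaticCellLaw`, line `floquet-bloch`, stub `stub_upperSome`: the LOWER slaved-ladder functional over one
# trapezoid slot

Summits-side helper (everything proved; no definitions, no named facts; `--supports stmt-AnomalousDissipation-20446`).
Mirror image of `slavedLadder_trapezoid` (`…SlavedLadderTrapezoid`, UPPER bound): the coupling of a lattice-word slot is
`g(t) = g₁ · trapezoid 0 τ ρ (t − t₀)`; applying `slavedLadder_window_ge` on the three affine pieces (primitives of `g²`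
explicit; `∫g² = g₁²τ(1 − 4ρ/3)`) and using that the slaving profile vanishes at the two ends of the slot, one gets for the
functional `Ψ = ‖v₀‖² − β Σ_{J≠0} ‖v_J − h_J v₀‖²` the LOWER slot law
`exp(−E)·‖v₀(t₀)‖² − β Σ_{J≠0}‖v_J(t₀)‖² ≤ ‖v₀(t₀+τ)‖² − β Σ_{J≠0}‖v_J(t₀+τ)‖²`,
`E = 2Λτ(d₀ + (1+ε)σ g₁²(1 − 4ρ/3)) + 40βγ²Λτg₁⁴(1 + g₁²σ²)/Δ³ + 48βγ²g₁²/(ρτΛΔ³)`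
(`slavedLadder_trapezoid_ge`), together with the interior form `exp(−E)·‖v₀(t₀)‖² − β Σ_{J≠0}‖v_J(t₀)‖² ≤ ‖v₀(t)‖²` for every
`t` in the slot. The initial functional has no sign, so the exact exponent `X(t) ∈ [0, E]` is carried to the end and only then
replaced by `E` on the slow term and by `0` on the fast term.
-/

set_option linter.dupNamespace false -- layout D-0017: `AnomalousDissipation.AnomalousDissipation` repeats by design

namespace Summit.AnomalousDissipation.AnomalousDissipation.Theorems.SolenoidalFractalHomogenisation.RealisedQuasiStaticCellLaw

noncomputable section

open Set Finset Complex
open scoped BigOperators ComplexConjugate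
open Literature.Analysis.FluidPDE Literature.Analysis.FluidPDE.LatticeShear

/-- Splitting an exponential lower bound of a difference: if `0 ≤ X ≤ E`, `0 ≤ A`, `0 ≤ B` and `exp(−X)(A − B) ≤ C` then
`exp(−E) A − B ≤ C`. -/
theorem exp_neg_mul_sub_le_of_le {X E A B C : ℝ} (hX0 : 0 ≤ X) (hXE : X ≤ E) (hA : 0 ≤ A) (hB : 0 ≤ B)
    (h : Real.exp (-X) * (A - B) ≤ C) : Real.exp (-E) * A - B ≤ C := by
  have h1 : Real.exp (-E) * A ≤ Real.exp (-X) * A :=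
    mul_le_mul_of_nonneg_right (Real.exp_le_exp.2 (by linarith)) hA
  have h2 : Real.exp (-X) * B ≤ 1 * B :=
    mul_le_mul_of_nonneg_right (by rw [← Real.exp_zero]; exact Real.exp_le_exp.2 (by linarith)) hB
  nlinarith [h1, h2, h]

/-- The slack of the three affine pieces of a trapezoid slot (ramps: derivative bound `|g₁|/(ρτ)`; plateau: `0`),
simplified: `2μ(|g₁|/(ρτ))·2ρτ + 2μ(0)·(τ − 2ρτ) ≤ 40βγ²Λτg₁⁴(1+g₁²σ²)/Δ³ + 48βγ²g₁²/(ρτΛΔ³)`,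
`μ(g_D) = 4βγ²(Λ|g₁|³σ + g_D + Λg₁²)²/(ΛΔ³)` (the computation inside `slavedLadder_trapezoid`, isolated). -/
theorem trapezoid_slack_le (β γ Λ τ g₁ σ Δ ρ : ℝ) (hβ : 0 ≤ β) (hΛ : 0 < Λ) (hΔ0 : 0 < Δ) (hτ : 0 < τ)
    (hρ : 0 < ρ) (hρ2 : ρ ≤ 1 / 2) :
    2 * ((fun gD : ℝ => 4 * β * γ ^ 2 * (Λ * |g₁| ^ 3 * σ + gD + Λ * |g₁| ^ 2) ^ 2 / (Λ * Δ ^ 3)) (|g₁| / (ρ * τ))) *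
        (2 * (ρ * τ)) +
      2 * ((fun gD : ℝ => 4 * β * γ ^ 2 * (Λ * |g₁| ^ 3 * σ + gD + Λ * |g₁| ^ 2) ^ 2 / (Λ * Δ ^ 3)) 0) *
        (τ - 2 * (ρ * τ)) ≤
      40 * β * γ ^ 2 * Λ * τ * g₁ ^ 4 * (1 + g₁ ^ 2 * σ ^ 2) / Δ ^ 3 +
        48 * β * γ ^ 2 * g₁ ^ 2 / (ρ * τ * Λ * Δ ^ 3) := by
  have hρτ : 0 < ρ * τ := mul_pos hρ hτ
  have h2ρτ : 2 * (ρ * τ) ≤ τ := by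
    have := mul_le_mul_of_nonneg_right hρ2 hτ.le; linarith only [this]
  simp only
  obtain ⟨a, ha⟩ : ∃ a : ℝ, a = |g₁| := ⟨_, rfl⟩
  have ha0 : 0 ≤ a := by rw [ha]; exact abs_nonneg _
  have e2 : a ^ 2 = g₁ ^ 2 := by rw [ha]; exact sq_abs _
  have e4 : a ^ 4 = g₁ ^ 4 := by rw [ha]; exact (by decide : Even 4).pow_abs g₁
  rw [← ha]
  obtain ⟨K, hK⟩ : ∃ K : ℝ, K = 8 * β * γ ^ 2 / (Λ * Δ ^ 3) := ⟨_, rfl⟩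
  have hK0 : 0 ≤ K := by rw [hK]; positivity
  obtain ⟨P, hP⟩ : ∃ P : ℝ, P = Λ * a ^ 3 * σ := ⟨_, rfl⟩
  obtain ⟨Q, hQ⟩ : ∃ Q : ℝ, Q = a / (ρ * τ) := ⟨_, rfl⟩
  obtain ⟨R, hR⟩ : ∃ R : ℝ, R = Λ * a ^ 2 := ⟨_, rfl⟩
  have eL : 2 * (4 * β * γ ^ 2 * (Λ * a ^ 3 * σ + a / (ρ * τ) + Λ * a ^ 2) ^ 2 / (Λ * Δ ^ 3)) * (2 * (ρ * τ)) +
      2 * (4 * β * γ ^ 2 * (Λ * a ^ 3 * σ + 0 + Λ * a ^ 2) ^ 2 / (Λ * Δ ^ 3)) * (τ - 2 * (ρ * τ)) =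
      K * (2 * (ρ * τ)) * (P + Q + R) ^ 2 + K * (τ - 2 * (ρ * τ)) * (P + R) ^ 2 := by
    rw [hK, hP, hQ, hR, add_zero]; ring
  rw [eL]
  have hsq3 : (P + Q + R) ^ 2 ≤ 3 * (P ^ 2 + Q ^ 2 + R ^ 2) := by
    linarith only [sq_nonneg (P - Q), sq_nonneg (P - R), sq_nonneg (Q - R)]
  have hsq2 : (P + R) ^ 2 ≤ 2 * (P ^ 2 + R ^ 2) := by linarith only [sq_nonneg (P - R)]
  have hw1 : 0 ≤ K * (2 * (ρ * τ)) := mul_nonneg hK0 (by positivity)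
  have hw2 : 0 ≤ K * (τ - 2 * (ρ * τ)) := mul_nonneg hK0 (by linarith [h2ρτ])
  have t1 := mul_le_mul_of_nonneg_left hsq3 hw1
  have t2 := mul_le_mul_of_nonneg_left hsq2 hw2
  have eM : K * (2 * (ρ * τ)) * (3 * (P ^ 2 + Q ^ 2 + R ^ 2)) + K * (τ - 2 * (ρ * τ)) * (2 * (P ^ 2 + R ^ 2)) =
      K * τ * (2 + 2 * ρ) * (P ^ 2 + R ^ 2) + 6 * K * a ^ 2 / (ρ * τ) := by
    rw [hQ]; field_simp; ring
  have hPR : 0 ≤ K * τ * (P ^ 2 + R ^ 2) := by positivity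
  have hM1 : K * τ * (2 + 2 * ρ) * (P ^ 2 + R ^ 2) ≤ 3 * (K * τ * (P ^ 2 + R ^ 2)) := by
    have := mul_le_mul_of_nonneg_left (show 2 + 2 * ρ ≤ 3 by linarith only [hρ2]) hPR
    linarith only [this]
  have ePR : 3 * (K * τ * (P ^ 2 + R ^ 2)) = 24 * β * γ ^ 2 * Λ * τ * a ^ 4 * (1 + a ^ 2 * σ ^ 2) / Δ ^ 3 := by
    rw [hK, hP, hR]; field_simp; ring
  have eQ : 6 * K * a ^ 2 / (ρ * τ) = 48 * β * γ ^ 2 * a ^ 2 / (ρ * τ * Λ * Δ ^ 3) := by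
    rw [hK]; field_simp; ring
  have hA : 0 ≤ β * γ ^ 2 * Λ * τ * a ^ 4 * (1 + a ^ 2 * σ ^ 2) / Δ ^ 3 := by positivity
  have e40 : 40 * β * γ ^ 2 * Λ * τ * a ^ 4 * (1 + a ^ 2 * σ ^ 2) / Δ ^ 3 =
      40 * (β * γ ^ 2 * Λ * τ * a ^ 4 * (1 + a ^ 2 * σ ^ 2) / Δ ^ 3) := by ring
  have e24 : 24 * β * γ ^ 2 * Λ * τ * a ^ 4 * (1 + a ^ 2 * σ ^ 2) / Δ ^ 3 =
      24 * (β * γ ^ 2 * Λ * τ * a ^ 4 * (1 + a ^ 2 * σ ^ 2) / Δ ^ 3) := by ring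
  rw [e2, e4] at *
  linarith only [t1, t2, eM, hM1, ePR, eQ, hA, e40, e24]

set_option maxHeartbeats 400000 in -- three windows chained with explicit cubic primitives
/-- **LOWER slot law of the slaved-ladder functional (trapezoid coupling).** For the three-term ladder on `W ∋ 0, ±1` over
the slot `[t₀, t₀ + τ]` with coupling `g(t) = g₁·trapezoid 0 τ ρ (t − t₀)` (`0 < ρ ≤ 1/2`), links `|s_J| ≤ 1`, gap `Δ` with
`d₀ ≥ 0`, `γ² = s₀² + s₋₁² ≤ βΔεσ`, and the weak-coupling hypothesis
`g₁²(4γ²/Δ + 2(1+ε)σ) + 2μ₁/Λ ≤ Δ`, `μ₁ = 4βγ²(Λ|g₁|³σ + |g₁|/(ρτ) + Λg₁²)²/(ΛΔ³)` (the ramp value of the slack): with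
`E = 2Λτ(d₀ + (1+ε)σg₁²(1−4ρ/3)) + 40βγ²Λτg₁⁴(1+g₁²σ²)/Δ³ + 48βγ²g₁²/(ρτΛΔ³)` and `Z₀ = Σ_{J≠0}‖v_J(t₀)‖²`,
(i) `exp(−E)‖v₀(t₀)‖² − βZ₀ ≤ ‖v₀(t₀+τ)‖² − βΣ_{J≠0}‖v_J(t₀+τ)‖²`, and (ii) `exp(−E)‖v₀(t₀)‖² − βZ₀ ≤ ‖v₀(t)‖²` for all
`t ∈ [t₀, t₀+τ]`. -/
theorem slavedLadder_trapezoid_ge (W : Finset ℤ) (h0 : (0 : ℤ) ∈ W) (h1 : (1 : ℤ) ∈ W) (hm1 : (-1 : ℤ) ∈ W)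
    (d s : ℤ → ℝ) (Λ Δ γ σ ε β g₁ τ ρ t₀ : ℝ) (g : ℝ → ℝ) (v : ℝ → ℤ → ℂ)
    (hs : ∀ J ∈ W, |s J| ≤ 1) (hγ : γ ^ 2 = s 0 ^ 2 + s (-1) ^ 2) (hγ0 : 0 ≤ γ)
    (hσ : σ = s (-1) ^ 2 / (d (-1) - d 0) + s 0 ^ 2 / (d 1 - d 0))
    (hΔ0 : 0 < Δ) (hΔ : ∀ J ∈ W, J ≠ 0 → d 0 + Δ ≤ d J) (hd0 : 0 ≤ d 0) (hΛ : 0 < Λ) (hε : 0 ≤ ε) (hβ : 0 ≤ β)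
    (hβγ : γ ^ 2 ≤ β * Δ * ε * σ) (hτ : 0 < τ) (hρ : 0 < ρ) (hρ2 : ρ ≤ 1 / 2)
    (hgdef : ∀ t ∈ Icc t₀ (t₀ + τ), g t = g₁ * LatticeWord.trapezoid 0 τ ρ (t - t₀))
    (hsmall : g₁ ^ 2 * (4 * γ ^ 2 / Δ + 2 * (1 + ε) * σ) +
      2 * (4 * β * γ ^ 2 * (Λ * |g₁| ^ 3 * σ + |g₁| / (ρ * τ) + Λ * |g₁| ^ 2) ^ 2 / (Λ * Δ ^ 3)) / Λ ≤ Δ)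
    (hsupp : ∀ t ∈ Icc t₀ (t₀ + τ), ∀ J, J ∉ W → v t J = 0)
    (hderiv : ∀ t ∈ Icc t₀ (t₀ + τ), ∀ J ∈ W, HasDerivWithinAt (fun τ' => v τ' J)
        (-(Λ : ℂ) * ((d J : ℂ) * v t J) -
          (g t : ℂ) * (Λ : ℂ) * ((s (J - 1) : ℂ) * v t (J - 1) - (s J : ℂ) * v t (J + 1))) (Icc t₀ (t₀ + τ)) t) :
    (Real.exp (-(2 * Λ * τ * (d 0 + (1 + ε) * σ * (g₁ ^ 2 * (1 - 4 * ρ / 3))) +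
          40 * β * γ ^ 2 * Λ * τ * g₁ ^ 4 * (1 + g₁ ^ 2 * σ ^ 2) / Δ ^ 3 +
          48 * β * γ ^ 2 * g₁ ^ 2 / (ρ * τ * Λ * Δ ^ 3))) * ‖v t₀ 0‖ ^ 2 -
        β * ∑ J ∈ W.erase 0, ‖v t₀ J‖ ^ 2 ≤
      ‖v (t₀ + τ) 0‖ ^ 2 - β * ∑ J ∈ W.erase 0, ‖v (t₀ + τ) J‖ ^ 2) ∧
    ∀ t ∈ Icc t₀ (t₀ + τ),
      Real.exp (-(2 * Λ * τ * (d 0 + (1 + ε) * σ * (g₁ ^ 2 * (1 - 4 * ρ / 3))) +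
          40 * β * γ ^ 2 * Λ * τ * g₁ ^ 4 * (1 + g₁ ^ 2 * σ ^ 2) / Δ ^ 3 +
          48 * β * γ ^ 2 * g₁ ^ 2 / (ρ * τ * Λ * Δ ^ 3))) * ‖v t₀ 0‖ ^ 2 -
        β * ∑ J ∈ W.erase 0, ‖v t₀ J‖ ^ 2 ≤ ‖v t 0‖ ^ 2 := by
  classical
  have hρτ : 0 < ρ * τ := mul_pos hρ hτ
  have hδp0 : 0 < d 1 - d 0 := by linarith [hΔ 1 h1 (by norm_num)]
  have hδm0 : 0 < d (-1) - d 0 := by linarith [hΔ (-1) hm1 (by norm_num)]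
  have hσ0 : 0 ≤ σ := by rw [hσ]; positivity
  -- the slack as a function of the derivative bound, and its monotonicity
  obtain ⟨μf, hμf⟩ : ∃ μf : ℝ → ℝ, μf = fun gD =>
      4 * β * γ ^ 2 * (Λ * |g₁| ^ 3 * σ + gD + Λ * |g₁| ^ 2) ^ 2 / (Λ * Δ ^ 3) := ⟨_, rfl⟩
  have hμf0 : ∀ gD, 0 ≤ gD → 0 ≤ μf gD := fun gD hgD => by rw [hμf]; positivity
  have hμf_mono : ∀ gD, 0 ≤ gD → gD ≤ |g₁| / (ρ * τ) → μf gD ≤ μf (|g₁| / (ρ * τ)) := by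
    intro gD hgD hle
    rw [hμf]
    have hb0 : 0 ≤ Λ * |g₁| ^ 3 * σ + gD + Λ * |g₁| ^ 2 := by positivity
    have hb : Λ * |g₁| ^ 3 * σ + gD + Λ * |g₁| ^ 2 ≤ Λ * |g₁| ^ 3 * σ + |g₁| / (ρ * τ) + Λ * |g₁| ^ 2 := by
      linarith
    exact div_le_div_of_nonneg_right (mul_le_mul_of_nonneg_left (pow_le_pow_left₀ hb0 hb 2) (by positivity))
      (by positivity)
  have hsmall_of : ∀ gD, 0 ≤ gD → gD ≤ |g₁| / (ρ * τ) →
      |g₁| ^ 2 * (4 * γ ^ 2 / Δ + 2 * (1 + ε) * σ) +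
        2 * (4 * β * γ ^ 2 * (Λ * |g₁| ^ 3 * σ + gD + Λ * |g₁| ^ 2) ^ 2 / (Λ * Δ ^ 3)) / Λ ≤ Δ := by
    intro gD hgD hle
    have h1 := hμf_mono gD hgD hle
    simp only [hμf] at h1
    have h2 : 2 * (4 * β * γ ^ 2 * (Λ * |g₁| ^ 3 * σ + gD + Λ * |g₁| ^ 2) ^ 2 / (Λ * Δ ^ 3)) / Λ ≤
        2 * (4 * β * γ ^ 2 * (Λ * |g₁| ^ 3 * σ + |g₁| / (ρ * τ) + Λ * |g₁| ^ 2) ^ 2 / (Λ * Δ ^ 3)) / Λ :=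
      div_le_div_of_nonneg_right (by linarith) hΛ.le
    have e : |g₁| ^ 2 * (4 * γ ^ 2 / Δ + 2 * (1 + ε) * σ) = g₁ ^ 2 * (4 * γ ^ 2 / Δ + 2 * (1 + ε) * σ) := by
      rw [sq_abs]
    linarith only [h2, hsmall, e]
  -- the functional as a function of time
  obtain ⟨Ψ, hΨ⟩ : ∃ Ψ : ℝ → ℝ, Ψ = fun t => ‖v t 0‖ ^ 2 - β * ∑ J ∈ W.erase 0,
      ‖v t J - ((if J = 1 then -(g t * s 0 / (d 1 - d 0))
          else if J = -1 then g t * s (-1) / (d (-1) - d 0) else 0 : ℝ) : ℂ) * v t 0‖ ^ 2 := ⟨_, rfl⟩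
  have hΨle : ∀ t, Ψ t ≤ ‖v t 0‖ ^ 2 := by
    intro t
    rw [hΨ]
    have : 0 ≤ β * ∑ J ∈ W.erase 0,
        ‖v t J - ((if J = 1 then -(g t * s 0 / (d 1 - d 0))
            else if J = -1 then g t * s (-1) / (d (-1) - d 0) else 0 : ℝ) : ℂ) * v t 0‖ ^ 2 := by positivity
    linarith
  -- at the two ends of the slot the profile vanishes
  have hΨend : ∀ t, g t = 0 → Ψ t = ‖v t 0‖ ^ 2 - β * ∑ J ∈ W.erase 0, ‖v t J‖ ^ 2 := by
    intro t hgt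
    rw [hΨ]
    simp only [hgt, zero_mul, neg_zero, zero_div, ite_self, Complex.ofReal_zero, sub_zero]
  have hg_t₀ : g t₀ = 0 := by
    rw [hgdef t₀ ⟨le_rfl, by linarith⟩, sub_self,
      trapezoid_eq_of_mem_ramp_up hτ hρ hρ2 ⟨le_rfl, hρτ.le⟩, zero_div, mul_zero]
  have hg_t₁ : g (t₀ + τ) = 0 := by
    rw [hgdef (t₀ + τ) ⟨by linarith, le_rfl⟩, add_sub_cancel_left,
      trapezoid_eq_of_mem_ramp_down hτ hρ hρ2 ⟨by linarith [mul_pos hρ hτ], le_rfl⟩, sub_self, zero_div, mul_zero]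
  -- the generic piece: an affine `g` on a sub-window `[a, b] ⊆ [t₀, t₀ + τ]`; exponent at `t` and its range
  have hpiece : ∀ (a b c₀ c₁ gD : ℝ), t₀ ≤ a → a ≤ b → b ≤ t₀ + τ →
      (∀ t ∈ Icc a b, g t = c₀ + c₁ * t) → |c₁| ≤ gD → 0 ≤ gD → gD ≤ |g₁| / (ρ * τ) →
      (∀ t ∈ Icc a b, |g t| ≤ |g₁|) →
      ∀ t ∈ Icc a b,
        Real.exp (-(2 * Λ * (d 0 * (t - a) + (1 + ε) * σ *
          (((c₀ + c₁ * t) ^ 3 / (3 * c₁) * (if c₁ = 0 then 0 else 1) + c₀ ^ 2 * t * (if c₁ = 0 then 1 else 0)) -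
            ((c₀ + c₁ * a) ^ 3 / (3 * c₁) * (if c₁ = 0 then 0 else 1) + c₀ ^ 2 * a * (if c₁ = 0 then 1 else 0)))) +
          2 * μf gD * (t - a))) * Ψ a ≤ Ψ t ∧
        0 ≤ 2 * Λ * (d 0 * (t - a) + (1 + ε) * σ *
          (((c₀ + c₁ * t) ^ 3 / (3 * c₁) * (if c₁ = 0 then 0 else 1) + c₀ ^ 2 * t * (if c₁ = 0 then 1 else 0)) -
            ((c₀ + c₁ * a) ^ 3 / (3 * c₁) * (if c₁ = 0 then 0 else 1) + c₀ ^ 2 * a * (if c₁ = 0 then 1 else 0)))) +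
          2 * μf gD * (t - a) ∧
        2 * Λ * (d 0 * (t - a) + (1 + ε) * σ *
          (((c₀ + c₁ * t) ^ 3 / (3 * c₁) * (if c₁ = 0 then 0 else 1) + c₀ ^ 2 * t * (if c₁ = 0 then 1 else 0)) -
            ((c₀ + c₁ * a) ^ 3 / (3 * c₁) * (if c₁ = 0 then 0 else 1) + c₀ ^ 2 * a * (if c₁ = 0 then 1 else 0)))) +
          2 * μf gD * (t - a) ≤
        2 * Λ * (d 0 * (b - a) + (1 + ε) * σ *
          (((c₀ + c₁ * b) ^ 3 / (3 * c₁) * (if c₁ = 0 then 0 else 1) + c₀ ^ 2 * b * (if c₁ = 0 then 1 else 0)) -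
            ((c₀ + c₁ * a) ^ 3 / (3 * c₁) * (if c₁ = 0 then 0 else 1) + c₀ ^ 2 * a * (if c₁ = 0 then 1 else 0)))) +
          2 * μf gD * (b - a) := by
    intro a b c₀ c₁ gD ha hab hb hgab hc₁ hgD0 hgDle hgT t ht
    have hsub : Icc a b ⊆ Icc t₀ (t₀ + τ) := Icc_subset_Icc ha hb
    -- a primitive of `g²` on the piece
    obtain ⟨G, hG⟩ : ∃ G : ℝ → ℝ, G = fun t =>
        (c₀ + c₁ * t) ^ 3 / (3 * c₁) * (if c₁ = 0 then 0 else 1) + c₀ ^ 2 * t * (if c₁ = 0 then 1 else 0) :=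
      ⟨_, rfl⟩
    have hGd : ∀ t ∈ Icc a b, HasDerivWithinAt G (g t ^ 2) (Icc a b) t := by
      intro t ht
      rw [hgab t ht, hG]
      by_cases hc : c₁ = 0
      · simp only [hc, if_true, mul_zero, zero_add, add_zero, mul_one, zero_mul]
        have h := ((hasDerivWithinAt_id t (Icc a b)).const_mul (c₀ ^ 2))
        simpa using h
      · simp only [hc, if_false, mul_one, mul_zero, add_zero]
        have h1 : HasDerivWithinAt (fun t => c₀ + c₁ * t) c₁ (Icc a b) t := by
          simpa using ((hasDerivWithinAt_id t (Icc a b)).const_mul c₁).const_add c₀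
        have h2 := (h1.pow 3).div_const (3 * c₁)
        refine h2.congr_deriv ?_
        field_simp
        ring
    have hgd : ∀ t ∈ Icc a b, HasDerivWithinAt g c₁ (Icc a b) t := by
      intro t ht
      have h1 : HasDerivWithinAt (fun t => c₀ + c₁ * t) c₁ (Icc a b) t := by
        simpa using ((hasDerivWithinAt_id t (Icc a b)).const_mul c₁).const_add c₀
      exact h1.congr (fun y hy => hgab y hy) (hgab t ht)
    have hsmall' := hsmall_of gD hgD0 hgDle
    have h := slavedLadder_window_ge W h0 h1 hm1 d s Λ |g₁| gD Δ γ σ ε β a b g (fun _ => c₁) G v hs hγ hγ0 hσ hΔ0 hΔ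
      hd0 hΛ hε hβ hβγ hgT (fun t _ => hc₁) hgd hGd hsmall' (fun t ht => hsupp t (hsub ht))
      (fun t ht J hJ => (hderiv t (hsub ht) J hJ).mono hsub) t ht
    rw [hΨ, hμf]
    simp only [hG] at h
    exact h
  -- |g| ≤ |g₁| on the slot
  have hgT : ∀ t ∈ Icc t₀ (t₀ + τ), |g t| ≤ |g₁| := by
    intro t ht
    rw [hgdef t ht, abs_mul]
    have h01 : 0 ≤ LatticeWord.trapezoid 0 τ ρ (t - t₀) ∧ LatticeWord.trapezoid 0 τ ρ (t - t₀) ≤ 1 := by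
      unfold LatticeWord.trapezoid
      exact ⟨le_max_left _ _, max_le zero_le_one (min_le_left _ _)⟩
    rw [abs_of_nonneg h01.1]
    exact mul_le_of_le_one_right (abs_nonneg _) h01.2
  have h2ρτ : 2 * (ρ * τ) ≤ τ := by
    have := mul_le_mul_of_nonneg_right hρ2 hτ.le; linarith only [this]
  have hρτle : ρ * τ ≤ τ := by linarith only [h2ρτ, hρτ.le]
  have hgDr : (0:ℝ) ≤ |g₁| / (ρ * τ) := by positivity
  -- the exact total exponent and the claim: for every `t` in the slot some `X ∈ [0, Etot]` with `exp(−X)Ψ(t₀) ≤ Ψ(t)`,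
  -- and at `t₀ + τ` one may take `X = Etot`
  obtain ⟨Etot, hEtot⟩ : ∃ Etot : ℝ, Etot = 2 * Λ * τ * (d 0 + (1 + ε) * σ * (g₁ ^ 2 * (1 - 4 * ρ / 3))) +
      (2 * μf (|g₁| / (ρ * τ)) * (2 * (ρ * τ)) + 2 * μf 0 * (τ - 2 * (ρ * τ))) := ⟨_, rfl⟩
  have hclaim : (Real.exp (-Etot) * Ψ t₀ ≤ Ψ (t₀ + τ) ∧ 0 ≤ Etot) ∧
      ∀ t ∈ Icc t₀ (t₀ + τ), ∃ X, 0 ≤ X ∧ X ≤ Etot ∧ Real.exp (-X) * Ψ t₀ ≤ Ψ t := by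
    -- chaining tool
    have chain : ∀ {X S Pa Pt : ℝ}, Real.exp (-X) * Pa ≤ Pt → Real.exp (-S) * Ψ t₀ ≤ Pa →
        Real.exp (-(X + S)) * Ψ t₀ ≤ Pt := by
      intro X S Pa Pt h1 h2
      have h3 := mul_le_mul_of_nonneg_left h2 (Real.exp_pos (-X)).le
      rw [← mul_assoc, ← Real.exp_add, show -X + -S = -(X + S) by ring] at h3
      exact h3.trans h1
    by_cases hg0 : g₁ = 0
    · -- no coupling: one piece, `g ≡ 0`
      have hgz : ∀ t ∈ Icc t₀ (t₀ + τ), g t = 0 + 0 * t := by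
        intro t ht; rw [hgdef t ht, hg0]; ring
      have hP := hpiece t₀ (t₀ + τ) 0 0 0 le_rfl (by linarith) le_rfl hgz (by simp) le_rfl hgDr hgT
      have hEq : Etot = 2 * Λ * (d 0 * (t₀ + τ - t₀) + (1 + ε) * σ *
          (((0 + 0 * (t₀ + τ)) ^ 3 / (3 * 0) * (if (0:ℝ) = 0 then 0 else 1) + 0 ^ 2 * (t₀ + τ) * (if (0:ℝ) = 0 then 1 else 0)) -
            ((0 + 0 * t₀) ^ 3 / (3 * 0) * (if (0:ℝ) = 0 then 0 else 1) + 0 ^ 2 * t₀ * (if (0:ℝ) = 0 then 1 else 0)))) +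
          2 * μf 0 * (t₀ + τ - t₀) := by
        rw [hEtot, hg0, hμf]
        simp only [abs_zero, zero_div]
        ring
      refine ⟨⟨?_, ?_⟩, fun t ht => ?_⟩
      · have h := (hP (t₀ + τ) ⟨by linarith, le_rfl⟩).1
        rw [hEq]; exact h
      · have h := (hP (t₀ + τ) ⟨by linarith, le_rfl⟩).2.1
        rw [hEq]; exact h
      · obtain ⟨hA, hB, hC⟩ := hP t ht
        exact ⟨_, hB, by rw [hEq]; exact hC, hA⟩
    -- piece 1: the up-ramp `[t₀, t₀ + ρτ]`, `g = g₁ (t − t₀)/(ρτ)`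
    have hc1 : g₁ / (ρ * τ) ≠ 0 := div_ne_zero hg0 hρτ.ne'
    have hg1 : ∀ t ∈ Icc t₀ (t₀ + ρ * τ), g t = -(g₁ * t₀ / (ρ * τ)) + g₁ / (ρ * τ) * t := by
      intro t ht
      rw [hgdef t ⟨ht.1, by linarith [ht.2, hρτle]⟩,
        trapezoid_eq_of_mem_ramp_up hτ hρ hρ2 ⟨by linarith [ht.1], by linarith [ht.2]⟩]
      field_simp
      ring
    have hP1 := hpiece t₀ (t₀ + ρ * τ) (-(g₁ * t₀ / (ρ * τ))) (g₁ / (ρ * τ)) (|g₁| / (ρ * τ)) le_rfl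
      (by linarith [hρτ.le]) (by linarith [hρτle]) hg1 (by rw [abs_div, abs_of_pos hρτ]) hgDr le_rfl
      (fun t ht => hgT t ⟨ht.1, by linarith [ht.2, hρτle]⟩)
    -- piece 2: the plateau `[t₀ + ρτ, t₀ + τ − ρτ]`, `g = g₁`
    have hg2 : ∀ t ∈ Icc (t₀ + ρ * τ) (t₀ + τ - ρ * τ), g t = g₁ + 0 * t := by
      intro t ht
      rw [hgdef t ⟨by linarith [ht.1, hρτ.le], by linarith [ht.2, hρτ.le]⟩,
        trapezoid_eq_of_mem_plateau hτ hρ ⟨by linarith [ht.1], by linarith [ht.2]⟩]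
      ring
    have hP2 := hpiece (t₀ + ρ * τ) (t₀ + τ - ρ * τ) g₁ 0 0 (by linarith [hρτ.le]) (by linarith [h2ρτ])
      (by linarith [hρτ.le]) hg2 (by simp) le_rfl hgDr
      (fun t ht => hgT t ⟨by linarith [ht.1, hρτ.le], by linarith [ht.2, hρτ.le]⟩)
    -- piece 3: the down-ramp `[t₀ + τ − ρτ, t₀ + τ]`, `g = g₁ (t₀ + τ − t)/(ρτ)`
    have hc3 : -(g₁ / (ρ * τ)) ≠ 0 := neg_ne_zero.2 hc1
    have hg3 : ∀ t ∈ Icc (t₀ + τ - ρ * τ) (t₀ + τ), g t = g₁ * (t₀ + τ) / (ρ * τ) + (-(g₁ / (ρ * τ))) * t := by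
      intro t ht
      rw [hgdef t ⟨by linarith [ht.1, hρτle], ht.2⟩,
        trapezoid_eq_of_mem_ramp_down hτ hρ hρ2 ⟨by linarith [ht.1], by linarith [ht.2]⟩]
      field_simp
      ring
    have hP3 := hpiece (t₀ + τ - ρ * τ) (t₀ + τ) (g₁ * (t₀ + τ) / (ρ * τ)) (-(g₁ / (ρ * τ))) (|g₁| / (ρ * τ))
      (by linarith [hρτle]) (by linarith [hρτ.le]) le_rfl hg3 (by rw [abs_neg, abs_div, abs_of_pos hρτ]) hgDr le_rfl
      (fun t ht => hgT t ⟨by linarith [ht.1, hρτle], ht.2⟩)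
    -- the three full-piece exponents and their sum
    obtain ⟨hA1, hB1, _⟩ := hP1 (t₀ + ρ * τ) ⟨by linarith [hρτ.le], le_rfl⟩
    obtain ⟨hA2, hB2, _⟩ := hP2 (t₀ + τ - ρ * τ) ⟨by linarith [h2ρτ], le_rfl⟩
    obtain ⟨hA3, hB3, _⟩ := hP3 (t₀ + τ) ⟨by linarith [hρτ.le], le_rfl⟩
    have hsum : 2 * Λ * (d 0 * (t₀ + τ - (t₀ + τ - ρ * τ)) + (1 + ε) * σ *
          (((g₁ * (t₀ + τ) / (ρ * τ) + -(g₁ / (ρ * τ)) * (t₀ + τ)) ^ 3 / (3 * -(g₁ / (ρ * τ))) *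
                (if -(g₁ / (ρ * τ)) = 0 then 0 else 1) +
              (g₁ * (t₀ + τ) / (ρ * τ)) ^ 2 * (t₀ + τ) * (if -(g₁ / (ρ * τ)) = 0 then 1 else 0)) -
            ((g₁ * (t₀ + τ) / (ρ * τ) + -(g₁ / (ρ * τ)) * (t₀ + τ - ρ * τ)) ^ 3 / (3 * -(g₁ / (ρ * τ))) *
                (if -(g₁ / (ρ * τ)) = 0 then 0 else 1) +
              (g₁ * (t₀ + τ) / (ρ * τ)) ^ 2 * (t₀ + τ - ρ * τ) * (if -(g₁ / (ρ * τ)) = 0 then 1 else 0)))) +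
          2 * μf (|g₁| / (ρ * τ)) * (t₀ + τ - (t₀ + τ - ρ * τ)) +
        (2 * Λ * (d 0 * (t₀ + τ - ρ * τ - (t₀ + ρ * τ)) + (1 + ε) * σ *
          (((g₁ + 0 * (t₀ + τ - ρ * τ)) ^ 3 / (3 * 0) * (if (0:ℝ) = 0 then 0 else 1) +
              g₁ ^ 2 * (t₀ + τ - ρ * τ) * (if (0:ℝ) = 0 then 1 else 0)) -
            ((g₁ + 0 * (t₀ + ρ * τ)) ^ 3 / (3 * 0) * (if (0:ℝ) = 0 then 0 else 1) +
              g₁ ^ 2 * (t₀ + ρ * τ) * (if (0:ℝ) = 0 then 1 else 0)))) +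
          2 * μf 0 * (t₀ + τ - ρ * τ - (t₀ + ρ * τ)) +
        (2 * Λ * (d 0 * (t₀ + ρ * τ - t₀) + (1 + ε) * σ *
          (((-(g₁ * t₀ / (ρ * τ)) + g₁ / (ρ * τ) * (t₀ + ρ * τ)) ^ 3 / (3 * (g₁ / (ρ * τ))) *
                (if g₁ / (ρ * τ) = 0 then 0 else 1) +
              (-(g₁ * t₀ / (ρ * τ))) ^ 2 * (t₀ + ρ * τ) * (if g₁ / (ρ * τ) = 0 then 1 else 0)) -
            ((-(g₁ * t₀ / (ρ * τ)) + g₁ / (ρ * τ) * t₀) ^ 3 / (3 * (g₁ / (ρ * τ))) *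
                (if g₁ / (ρ * τ) = 0 then 0 else 1) +
              (-(g₁ * t₀ / (ρ * τ))) ^ 2 * t₀ * (if g₁ / (ρ * τ) = 0 then 1 else 0)))) +
          2 * μf (|g₁| / (ρ * τ)) * (t₀ + ρ * τ - t₀))) = Etot := by
      rw [hEtot]
      simp only [hc1, hc3, if_false, if_true]
      field_simp
      ring
    have hE0 : 0 ≤ Etot := by rw [← hsum]; linarith [hB1, hB2, hB3]
    refine ⟨⟨?_, hE0⟩, fun t ht => ?_⟩
    · have h := chain hA3 (chain hA2 hA1)
      rw [hsum] at h
      exact h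
    · -- locate `t` in one of the three pieces
      by_cases ht1 : t ≤ t₀ + ρ * τ
      · obtain ⟨hA, hB, hC⟩ := hP1 t ⟨ht.1, ht1⟩
        refine ⟨_, ?_, ?_, hA⟩
        · exact hB
        · rw [← hsum]; linarith only [hC, hB2, hB3]
      · by_cases ht2 : t ≤ t₀ + τ - ρ * τ
        · obtain ⟨hA, hB, hC⟩ := hP2 t ⟨(not_le.1 ht1).le, ht2⟩
          refine ⟨_, ?_, ?_, chain hA hA1⟩
          · linarith only [hB, hB1]
          · rw [← hsum]; linarith only [hC, hB3]
        · obtain ⟨hA, hB, hC⟩ := hP3 t ⟨(not_le.1 ht2).le, ht.2⟩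
          refine ⟨_, ?_, ?_, chain hA (chain hA2 hA1)⟩
          · linarith only [hB, hB1, hB2]
          · rw [← hsum]; linarith only [hC]
  -- simplifying the slack (same computation as in `slavedLadder_trapezoid`)
  have hslack : 2 * μf (|g₁| / (ρ * τ)) * (2 * (ρ * τ)) + 2 * μf 0 * (τ - 2 * (ρ * τ)) ≤
      40 * β * γ ^ 2 * Λ * τ * g₁ ^ 4 * (1 + g₁ ^ 2 * σ ^ 2) / Δ ^ 3 + 48 * β * γ ^ 2 * g₁ ^ 2 / (ρ * τ * Λ * Δ ^ 3) := by
    rw [hμf]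
    exact trapezoid_slack_le β γ Λ τ g₁ σ Δ ρ hβ hΛ hΔ0 hτ hρ hρ2
  have hEle : Etot ≤ 2 * Λ * τ * (d 0 + (1 + ε) * σ * (g₁ ^ 2 * (1 - 4 * ρ / 3))) +
      40 * β * γ ^ 2 * Λ * τ * g₁ ^ 4 * (1 + g₁ ^ 2 * σ ^ 2) / Δ ^ 3 + 48 * β * γ ^ 2 * g₁ ^ 2 / (ρ * τ * Λ * Δ ^ 3) := by
    rw [hEtot]; linarith [hslack]
  -- the initial functional split into its two (signed) parts
  have hV0 : 0 ≤ ‖v t₀ 0‖ ^ 2 := sq_nonneg _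
  have hZ0 : 0 ≤ β * ∑ J ∈ W.erase 0, ‖v t₀ J‖ ^ 2 := by positivity
  have hΨ0 : Ψ t₀ = ‖v t₀ 0‖ ^ 2 - β * ∑ J ∈ W.erase 0, ‖v t₀ J‖ ^ 2 := hΨend t₀ hg_t₀
  obtain ⟨⟨hend, hE0⟩, hall⟩ := hclaim
  refine ⟨?_, fun t ht => ?_⟩
  · rw [← hΨend (t₀ + τ) hg_t₁]
    rw [hΨ0] at hend
    exact exp_neg_mul_sub_le_of_le hE0 hEle hV0 hZ0 hend
  · obtain ⟨X, hX0, hXE, hX⟩ := hall t ht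
    rw [hΨ0] at hX
    exact (exp_neg_mul_sub_le_of_le hX0 (hXE.trans hEle) hV0 hZ0 hX).trans (hΨle t)

end

end Summit.AnomalousDissipation.AnomalousDissipation.Theorems.SolenoidalFractalHomogenisation.RealisedQuasiStaticCellLaw
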